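import Summits.HubbardSuperconductivity.HubbardSuperconductivity.Theses.EatTheGoldstone
import Literature.MathematicalPhysics.QuantumLattice.HubbardTorusFluxBlochBound

/-!
# Route `EatTheGoldstone`, support `TwistEnergyBounds` (stmt-HubbardSuperconductivity-1631): proof

`Summit.HubbardSuperconductivity.HubbardSuperconductivity.Theses.EatTheGoldstone.TwistEnergyBounds`
concerns the GRAPH-FORM uniformly twisted Hubbard torus inlined in the route file,
`H(θ) = −Σ_{x∼y,σ} e^{iθ s(x,y)/L} c†_{xσ}c_{yσ} + U Σ n↑n↓` (`s = +1` if `y = x + e₁` (and not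
`x = y + e₁`), `−1` if `x = y + e₁` (and not `y = x + e₁`), else `0`), and its sector energy
`E(θ) = minEnergyOn (H θ) (szSector N_L 0)`. The four clauses:

* (a) `H 0 = hubbardTorus 2 L 1 U` (`e^0 = 1`);
* (b) `E(−θ) = E(θ)` (`L ≥ 3`: `E(θ)` is the flux envelope, even by time reversal, `fluxEnergy_neg`;
  `L ≤ 2`: `H(θ) = H(0)`);
* (c) `E(θ + 2π) = E(θ)`: for `L ≥ 3`, `H(θ)` IS the Peierls torus in the uniform gauge,
  `magneticHubbardTorus L (uniformTwistConfig L (−θ)) 1 U` (`twistH_eq_magneticHubbardTorus`, the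
  ordered-pair ↔ oriented-edge bookkeeping of `MagneticHubbardTorusTrivialField`), whose sector energy
  is the flux envelope `fluxEnergy L U δ (−θ)` (`fluxEnergy_eq_minEnergyOn_uniformTwistConfig`,
  Literature `MagneticHubbardTorusGauge`), `2π`-periodic (`fluxEnergy_periodic`); for `L ≤ 2` every
  sign `s(x,y)` vanishes (`2e₁ = 0`), so `H(θ) = H(0)`;
* (d) `L ≥ 3`: `E(θ) − E(0) ≤ 2θ²` — Bloch's bound `fluxEnergy_le_fluxEnergy_zero_add_two_mul_sq`
  (Literature `HubbardTorusFluxBlochBound`).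

Sources: W. Kohn, Phys. Rev. 133 (1964) A171; N. Byers, C. N. Yang, PRL 7 (1961) 46; H. Tasaki
(2022) §3.1; T. Koma, H. Tasaki, PRL 68 (1992) 3248; D. Bohm, Phys. Rev. 75 (1949) 502; H. Watanabe,
J. Stat. Phys. 177 (2019) 717. No definitions are introduced.
-/

noncomputable section

namespace Summit.HubbardSuperconductivity.HubbardSuperconductivity.Theorems.EatTheGoldstone

set_option linter.dupNamespace false -- summit = problem name (single-conjunct summit), D-0017

open Matrix Finset
open scoped ComplexConjugate
open Literature.MathematicalPhysics.QuantumLattice Literature.MathematicalPhysics.QuantumFieldTheory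

variable {L : ℕ} [NeZero L]

/-! ### The sign function of the inline twist -/

omit [NeZero L] in
/-- `eᵢ + e₀ ≠ 0` on `(ℤ/L)²` for `L ≥ 3`, in the form `x ≠ x + eᵢ + e₀`. [folklore] -/
theorem ne_add_single_add_single (hL : 3 ≤ L) (x : Site 2 L) (i : Fin 2) :
    x ≠ x + Pi.single i 1 + Pi.single 0 1 := by
  intro h
  have h' : (Pi.single i 1 : Site 2 L) + Pi.single 0 1 = 0 := by
    have := congrArg (fun y => y - x) h
    simpa [add_assoc] using this.symm
  exact torusUnit_add_torusUnit_ne_zero hL i 0 h'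

omit [NeZero L] in
/-- `x + eᵢ = x + e₀ ↔ i = 0` on `(ℤ/L)²` for `L ≥ 2`. [folklore] -/
theorem add_single_eq_add_single_zero_iff (hL : 2 ≤ L) (x : Site 2 L) (i : Fin 2) :
    x + Pi.single i 1 = x + Pi.single 0 1 ↔ i = 0 := by
  constructor
  · intro h
    have h' : (Pi.single i 1 : Site 2 L) = Pi.single 0 1 := add_left_cancel h
    fin_cases i
    · rfl
    · exact absurd h'.symm (torusUnit_zero_ne_one hL)
  · rintro rfl; rfl

omit [NeZero L] in
/-- The inline twist sign on the ordered pair `(x, x + eᵢ)` (`L ≥ 3`): `+1` on `e₀`-bonds, `0` on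
`e₁`-bonds. [folklore] -/
theorem twistSign_forward (hL : 3 ≤ L) (x : Site 2 L) (i : Fin 2) :
    (if x + Pi.single i 1 = x + Pi.single 0 1 ∧ x ≠ x + Pi.single i 1 + Pi.single 0 1 then (1 : ℂ)
      else if x = x + Pi.single i 1 + Pi.single 0 1 ∧ x + Pi.single i 1 ≠ x + Pi.single 0 1 then -1
      else 0) = if i = 0 then 1 else 0 := by
  have h1 := ne_add_single_add_single hL x i
  by_cases hi : i = 0
  · subst hi
    simp [h1]
  · have h2 : ¬ (x + Pi.single i 1 = x + Pi.single 0 1) :=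
      fun h => hi ((add_single_eq_add_single_zero_iff (by omega) x i).1 h)
    simp [h1, h2, hi]

omit [NeZero L] in
/-- The inline twist sign on the ordered pair `(x + eᵢ, x)` (`L ≥ 3`): `−1` on `e₀`-bonds, `0` on
`e₁`-bonds. [folklore] -/
theorem twistSign_backward (hL : 3 ≤ L) (x : Site 2 L) (i : Fin 2) :
    (if x = x + Pi.single i 1 + Pi.single 0 1 ∧ x + Pi.single i 1 ≠ x + Pi.single 0 1 then (1 : ℂ)
      else if x + Pi.single i 1 = x + Pi.single 0 1 ∧ x ≠ x + Pi.single i 1 + Pi.single 0 1 then -1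
      else 0) = if i = 0 then -1 else 0 := by
  have h1 := ne_add_single_add_single hL x i
  by_cases hi : i = 0
  · subst hi
    simp [h1]
  · have h2 : ¬ (x + Pi.single i 1 = x + Pi.single 0 1) :=
      fun h => hi ((add_single_eq_add_single_zero_iff (by omega) x i).1 h)
    simp [h1, h2, hi]

/-- For `L ≤ 2` the inline twist sign vanishes identically: `b = a + e₀` forces `a = b + e₀`
(`2e₀ = 0`). [folklore] -/
theorem twistSign_eq_zero_of_le_two (hL : L ≤ 2) (a b : Site 2 L) :
    (if b = a + Pi.single 0 1 ∧ a ≠ b + Pi.single 0 1 then (1 : ℂ)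
      else if a = b + Pi.single 0 1 ∧ b ≠ a + Pi.single 0 1 then -1 else 0) = 0 := by
  have h2 : (Pi.single 0 1 : Site 2 L) + Pi.single 0 1 = 0 := by
    rw [← Pi.single_add]
    have h11 : (1 : ZMod L) + 1 = 0 := by
      have hL1 : 1 ≤ L := NeZero.one_le
      interval_cases L <;> decide
    rw [h11, Pi.single_zero]
  have key : ∀ a b : Site 2 L, b = a + Pi.single 0 1 → a = b + Pi.single 0 1 := fun a b h => by
    rw [h, add_assoc, h2, add_zero]
  by_cases hab : b = a + Pi.single 0 1
  · have hba := key a b hab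
    rw [if_neg (fun h => h.2 hba), if_neg (fun h => h.2 hab)]
  · by_cases hba : a = b + Pi.single 0 1
    · exact absurd (key b a hba) hab
    · rw [if_neg (fun h => hab h.1), if_neg (fun h => hba h.1)]

/-! ### The inline twisted Hamiltonian -/

omit [NeZero L] in
/-- **Clause (a), all `L`**: at zero twist the inline Hamiltonian is `hubbardTorus 2 L 1 U`
(`e^{0} = 1`). [folklore] -/
theorem twistH_zero (U : ℝ) :
    (-(∑ x : FermionTorus 2 L, ∑ y : FermionTorus 2 L, ∑ σ : Fin 2,
        (if (fermionTorusGraph 2 L).Adj x y then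
          Complex.exp (Complex.I * (((0 : ℝ) / L : ℝ) : ℂ) *
            (if FermionTorus.toTorusSite y = FermionTorus.toTorusSite x + Pi.single 0 1 ∧
                FermionTorus.toTorusSite x ≠ FermionTorus.toTorusSite y + Pi.single 0 1 then (1 : ℂ)
              else if FermionTorus.toTorusSite x = FermionTorus.toTorusSite y + Pi.single 0 1 ∧
                FermionTorus.toTorusSite y ≠ FermionTorus.toTorusSite x + Pi.single 0 1 then (-1 : ℂ)
              else 0)) •
            (creation (orb x σ) * annihilation (orb y σ)) else 0)) +
      (U : ℂ) • ∑ x : FermionTorus 2 L, numberOp x 0 * numberOp x 1) = hubbardTorus 2 L 1 U := by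
  simp only [zero_div, Complex.ofReal_zero, mul_zero, zero_mul, Complex.exp_zero, one_smul]
  rw [hubbardTorus, hamiltonian, Complex.ofReal_one, neg_smul, one_smul]

/-- For `L ≤ 2` the inline twisted Hamiltonian does not depend on `θ` (all signs vanish). [folklore] -/
theorem twistH_eq_twistH_zero_of_le_two (hL : L ≤ 2) (U θ : ℝ) :
    (-(∑ x : FermionTorus 2 L, ∑ y : FermionTorus 2 L, ∑ σ : Fin 2,
        (if (fermionTorusGraph 2 L).Adj x y then
          Complex.exp (Complex.I * ((θ / L : ℝ) : ℂ) *
            (if FermionTorus.toTorusSite y = FermionTorus.toTorusSite x + Pi.single 0 1 ∧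
                FermionTorus.toTorusSite x ≠ FermionTorus.toTorusSite y + Pi.single 0 1 then (1 : ℂ)
              else if FermionTorus.toTorusSite x = FermionTorus.toTorusSite y + Pi.single 0 1 ∧
                FermionTorus.toTorusSite y ≠ FermionTorus.toTorusSite x + Pi.single 0 1 then (-1 : ℂ)
              else 0)) •
            (creation (orb x σ) * annihilation (orb y σ)) else 0)) +
      (U : ℂ) • ∑ x : FermionTorus 2 L, numberOp x 0 * numberOp x 1) = hubbardTorus 2 L 1 U := by
  simp only [twistSign_eq_zero_of_le_two hL, mul_zero, Complex.exp_zero, one_smul]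
  rw [hubbardTorus, hamiltonian, Complex.ofReal_one, neg_smul, one_smul]

/-- **The inline twisted Hamiltonian is the Peierls torus in the uniform gauge** (`L ≥ 3`):
`H(θ) = magneticHubbardTorus L (uniformTwistConfig L (−θ)) 1 U` (the hop `x → x + e₁`, i.e.
`c†_{x+e₁} c_x`, carries `e^{−iθ/L}`; its reverse `c†_x c_{x+e₁}` carries `e^{+iθ/L}`; `e₂`-bonds are
untwisted). Ordered adjacent pairs of the torus graph are the oriented edges met in both orders
(`sum_sum_ite_torusGraph_two_adj`). [folklore] -/
theorem twistH_eq_magneticHubbardTorus (hL : 3 ≤ L) (U θ : ℝ) :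
    (-(∑ x : FermionTorus 2 L, ∑ y : FermionTorus 2 L, ∑ σ : Fin 2,
        (if (fermionTorusGraph 2 L).Adj x y then
          Complex.exp (Complex.I * ((θ / L : ℝ) : ℂ) *
            (if FermionTorus.toTorusSite y = FermionTorus.toTorusSite x + Pi.single 0 1 ∧
                FermionTorus.toTorusSite x ≠ FermionTorus.toTorusSite y + Pi.single 0 1 then (1 : ℂ)
              else if FermionTorus.toTorusSite x = FermionTorus.toTorusSite y + Pi.single 0 1 ∧
                FermionTorus.toTorusSite y ≠ FermionTorus.toTorusSite x + Pi.single 0 1 then (-1 : ℂ)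
              else 0)) •
            (creation (orb x σ) * annihilation (orb y σ)) else 0)) +
      (U : ℂ) • ∑ x : FermionTorus 2 L, numberOp x 0 * numberOp x 1) =
      magneticHubbardTorus L (uniformTwistConfig L (-θ)) 1 U := by
  rw [magneticHubbardTorus_one]
  congr 2
  -- transport the ordered-pair sum to `(ℤ/L)²`
  have htrans : (∑ x : FermionTorus 2 L, ∑ y : FermionTorus 2 L, ∑ σ : Fin 2,
        (if (fermionTorusGraph 2 L).Adj x y then
          Complex.exp (Complex.I * ((θ / L : ℝ) : ℂ) *
            (if FermionTorus.toTorusSite y = FermionTorus.toTorusSite x + Pi.single 0 1 ∧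
                FermionTorus.toTorusSite x ≠ FermionTorus.toTorusSite y + Pi.single 0 1 then (1 : ℂ)
              else if FermionTorus.toTorusSite x = FermionTorus.toTorusSite y + Pi.single 0 1 ∧
                FermionTorus.toTorusSite y ≠ FermionTorus.toTorusSite x + Pi.single 0 1 then (-1 : ℂ)
              else 0)) •
            (creation (orb x σ) * annihilation (orb y σ)) else 0)) =
      ∑ a : Site 2 L, ∑ b : Site 2 L,
        if (Literature.Probability.LatticeModels.torusGraph 2 L).Adj a b then
          ∑ σ : Fin 2, Complex.exp (Complex.I * ((θ / L : ℝ) : ℂ) *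
            (if b = a + Pi.single 0 1 ∧ a ≠ b + Pi.single 0 1 then (1 : ℂ)
              else if a = b + Pi.single 0 1 ∧ b ≠ a + Pi.single 0 1 then (-1 : ℂ) else 0)) •
            (creation (orb (FermionTorus.ofTorusSite a) σ) *
              annihilation (orb (FermionTorus.ofTorusSite b) σ) :
                Matrix (Finset (Orb (FermionTorus 2 L))) (Finset (Orb (FermionTorus 2 L))) ℂ)
        else 0 := by
    refine Fintype.sum_equiv FermionTorus.equivTorusSite _ _ fun u => ?_
    refine Fintype.sum_equiv FermionTorus.equivTorusSite _ _ fun v => ?_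
    rw [Finset.sum_ite_irrel, Finset.sum_const_zero]
    simp only [FermionTorus.equivTorusSite, Equiv.coe_fn_mk, fermionTorusGraph_adj,
      FermionTorus.ofTorusSite_toTorusSite]
    congr 1
  rw [htrans, sum_sum_ite_torusGraph_two_adj hL]
  refine Finset.sum_congr rfl fun x _ => Finset.sum_congr rfl fun i _ => ?_
  rw [← Finset.sum_add_distrib]
  refine Finset.sum_congr rfl fun σ _ => ?_
  rw [twistSign_backward hL x i, twistSign_forward hL x i]
  have hA0 : ((uniformTwistConfig L (-θ) (x, i) : Circle) : ℂ) =
      Complex.exp (Complex.I * ((θ / L : ℝ) : ℂ) * (if i = 0 then -1 else 0)) := by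
    rw [uniformTwistConfig_apply]
    by_cases hi : i = 0
    · rw [if_pos hi, if_pos hi, Circle.coe_exp]
      congr 1
      push_cast
      ring
    · rw [if_neg hi, if_neg hi, Circle.coe_one, mul_zero, Complex.exp_zero]
  have hA1 : (starRingEnd ℂ) ((uniformTwistConfig L (-θ) (x, i) : Circle) : ℂ) =
      Complex.exp (Complex.I * ((θ / L : ℝ) : ℂ) * (if i = 0 then 1 else 0)) := by
    rw [hA0, ← Complex.exp_conj]
    congr 1
    by_cases hi : i = 0
    · rw [if_pos hi, if_pos hi]
      simp only [map_mul, Complex.conj_I, Complex.conj_ofReal, map_neg, map_one]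
      ring
    · rw [if_neg hi, if_neg hi, mul_zero, map_zero]
  rw [hA1, hA0]
  rfl

/-! ### Sector energies of the inline twisted Hamiltonian -/

/-- For `L ≥ 3` the sector energy of the inline twisted Hamiltonian in `(N_L, 0)` is the flux
envelope: `E(θ) = fluxEnergy L U δ θ` (uniform gauge ≃ seam gauge, and evenness in `θ`). [folklore] -/
theorem twistE_eq_fluxEnergy (hL : 3 ≤ L) (U δ θ : ℝ) :
    (magneticHubbardTorus L (uniformTwistConfig L (-θ)) 1 U).minEnergyOn
        (szSector (Λ := FermionTorus 2 L) (2 * ⌊(1 - δ) * (L : ℝ) ^ 2 / 2⌋₊) 0) =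
      fluxEnergy L U δ θ := by
  rw [← fluxEnergy_eq_minEnergyOn_uniformTwistConfig hL, fluxEnergy_neg]

/-- **Clause (b), all `L`**: the sector energies of the inline twisted Hamiltonian are even in the
twist, `E(−θ) = E(θ)` (`L ≥ 3`: `E(θ) = fluxEnergy L U δ θ`, even by time reversal, `fluxEnergy_neg`;
`L ≤ 2`: `H(θ) = H(0)`). Byers–Yang (1961). [folklore] -/
theorem twistE_neg (U δ θ : ℝ) :
    (-(∑ x : FermionTorus 2 L, ∑ y : FermionTorus 2 L, ∑ σ : Fin 2,
        (if (fermionTorusGraph 2 L).Adj x y then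
          Complex.exp (Complex.I * (((-θ) / L : ℝ) : ℂ) *
            (if FermionTorus.toTorusSite y = FermionTorus.toTorusSite x + Pi.single 0 1 ∧
                FermionTorus.toTorusSite x ≠ FermionTorus.toTorusSite y + Pi.single 0 1 then (1 : ℂ)
              else if FermionTorus.toTorusSite x = FermionTorus.toTorusSite y + Pi.single 0 1 ∧
                FermionTorus.toTorusSite y ≠ FermionTorus.toTorusSite x + Pi.single 0 1 then (-1 : ℂ)
              else 0)) •
            (creation (orb x σ) * annihilation (orb y σ)) else 0)) +
      (U : ℂ) • ∑ x : FermionTorus 2 L, numberOp x 0 * numberOp x 1).minEnergyOn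
        (szSector (Λ := FermionTorus 2 L) (2 * ⌊(1 - δ) * (L : ℝ) ^ 2 / 2⌋₊) 0) =
    (-(∑ x : FermionTorus 2 L, ∑ y : FermionTorus 2 L, ∑ σ : Fin 2,
        (if (fermionTorusGraph 2 L).Adj x y then
          Complex.exp (Complex.I * ((θ / L : ℝ) : ℂ) *
            (if FermionTorus.toTorusSite y = FermionTorus.toTorusSite x + Pi.single 0 1 ∧
                FermionTorus.toTorusSite x ≠ FermionTorus.toTorusSite y + Pi.single 0 1 then (1 : ℂ)
              else if FermionTorus.toTorusSite x = FermionTorus.toTorusSite y + Pi.single 0 1 ∧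
                FermionTorus.toTorusSite y ≠ FermionTorus.toTorusSite x + Pi.single 0 1 then (-1 : ℂ)
              else 0)) •
            (creation (orb x σ) * annihilation (orb y σ)) else 0)) +
      (U : ℂ) • ∑ x : FermionTorus 2 L, numberOp x 0 * numberOp x 1).minEnergyOn
        (szSector (Λ := FermionTorus 2 L) (2 * ⌊(1 - δ) * (L : ℝ) ^ 2 / 2⌋₊) 0) := by
  rcases Nat.lt_or_ge L 3 with h | h
  · have hL2 : L ≤ 2 := by omega
    rw [twistH_eq_twistH_zero_of_le_two hL2, twistH_eq_twistH_zero_of_le_two hL2]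
  · rw [twistH_eq_magneticHubbardTorus h, twistH_eq_magneticHubbardTorus h,
      twistE_eq_fluxEnergy h U δ, twistE_eq_fluxEnergy h U δ, fluxEnergy_neg]

/-! ### Assembly -/

/-- **`TwistEnergyBounds` (item stmt-HubbardSuperconductivity-1631) holds.** For the inline
uniformly twisted Hubbard torus `H(θ)` of route `EatTheGoldstone` and its sector energy
`E(θ) = minEnergyOn (H θ) (N_L, 0)`: (a) `H 0 = hubbardTorus 2 L 1 U`; (b) `E(−θ) = E(θ)`;
(c) `E(θ + 2π) = E(θ)`; (d) for `L ≥ 3`, `E(θ) − E(0) ≤ 2θ²`. Kohn (1964); Byers–Yang (1961);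
Tasaki (2022) §3.1; Bohm (1949); Watanabe (2019) §2.2.1. -/
theorem twistEnergyBounds_proof :
    Summit.HubbardSuperconductivity.HubbardSuperconductivity.Theses.EatTheGoldstone.TwistEnergyBounds := by
  intro U δ L _
  dsimp only
  refine ⟨twistH_zero U, fun θ => twistE_neg U δ θ, fun θ => ?_, fun hL _ θ => ?_⟩
  · -- (c) periodicity
    rcases Nat.lt_or_ge L 3 with h | h
    · have hL2 : L ≤ 2 := by omega
      rw [twistH_eq_twistH_zero_of_le_two hL2, twistH_eq_twistH_zero_of_le_two hL2]
    · rw [twistH_eq_magneticHubbardTorus h, twistH_eq_magneticHubbardTorus h,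
        twistE_eq_fluxEnergy h U δ, twistE_eq_fluxEnergy h U δ, fluxEnergy_periodic]
  · -- (d) Bloch's bound
    rw [twistH_eq_magneticHubbardTorus hL, twistE_eq_fluxEnergy hL U δ, twistH_zero,
      ← hubbardTorusFlux_zero, ← fluxEnergy_eq]
    linarith [fluxEnergy_le_fluxEnergy_zero_add_two_mul_sq (L := L) U δ θ]

end Summit.HubbardSuperconductivity.HubbardSuperconductivity.Theorems.EatTheGoldstone
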